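import Literature.Analysis.FluidPDE.ClassicalSolutionRescale
import Literature.Analysis.FluidPDE.KNSSLocalSmoothingHolds
import HarnessLib

/-!
# Crux `FrequencyRigidity` (stmt-NavierStokesRegularity-2955), line `two-ended-pinning`:
  stub `stub_scaleInvariantBounds_of_unitTime`

Helper file (lands `--supports stmt-NavierStokesRegularity-2955`) proving the registered stub
`stub_scaleInvariantBounds_of_unitTime` of the line's skeleton: the **rescaling bookkeeping** that
transfers unit-time, unit-viscosity derivative bounds to scale-invariant bounds at every negative
time and every viscosity.

What is proved. Assume that for every Type-I constant `C` there are constants `C'_k` such that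
every classical Navier–Stokes flow `(u, p)` with viscosity `1` and zero force on `ℝ³ × (−∞, 0)`
obeying the global time-Type-I bound `‖u(t, x)‖ ≤ C/√(−t)` satisfies `‖Dᵏu(−1, x)‖ ≤ C'_k` for all
`k ≥ 1` and all `x`. Then for every viscosity `ν > 0` and every `C` there are constants `C''_k`
such that every classical flow `(v, q)` with viscosity `ν`, zero force and the Type-I bound with
constant `C` obeys `‖Dᵏv(t, x)‖ ≤ C''_k (−t)^{−(k+1)/2}` for all `k ≥ 1`, `t < 0`, `x`.

How. For `t < 0` put `L = √(−t)`, `m = √ν` and rescale space–time about the origin,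
`w(s, y) = (L/m) v(−t s, L m y)` (`IsClassicalNSSolutionOn.stRescale` with `α = L/m`,
`γ = L m`, `β = α γ = −t`): `w` is a classical flow with viscosity `α ν / γ = 1` and zero force on
`(−∞, 0)`, with the Type-I bound of constant `C/√ν`, and `w(−1, y) = (L/m) v(t, L m y)`. The
hypothesis bounds `‖Dᵏw(−1, ·)‖ ≤ C'_k`; undoing the homothety
(`norm_iteratedFDeriv_comp_smul_le`, `iteratedFDeriv_const_smul_real`) gives
`‖Dᵏv(t, x)‖ ≤ (m/L) (L m)^{−k} C'_k = √ν (√ν)^{−k} C'_k (−t)^{−(k+1)/2}`.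

Sources: Koch–Nadirashvili–Seregin–Šverák 2009, §1 (scaling (1.3)) and §4
[KochNadirashviliSereginSverak2009]; Leray 1934, §20 (similarity transformation) [Leray1934].
-/

noncomputable section

namespace Summit.NavierStokesRegularity.NavierStokesRegularity.Theorems.FrequencyRigidity.TwoEndedPinning

open Literature.Analysis.FluidPDE MeasureTheory Set Filter Topology Function
open scoped RealInnerProductSpace Laplacian ContDiff

/-- The affine time change `r ↦ 0 + β r` with `β > 0` pulls `(−∞, 0)` back to itself. [folklore] -/
private theorem preimage_zero_add_mul_Iio {β : ℝ} (hβ : 0 < β) :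
    ((fun r => (0 : ℝ) + β * r) ⁻¹' Iio 0) = Iio 0 := by
  ext r
  simp only [mem_preimage, mem_Iio, zero_add]
  constructor
  · intro h
    exact lt_of_mul_lt_mul_left (by rwa [mul_zero]) hβ.le
  · intro h
    exact mul_neg_of_pos_of_neg hβ h

/-- `(−t)^{−(k+1)/2} = (√(−t))⁻¹^{k+1}` for `t < 0`. [folklore] -/
private theorem rpow_neg_half_succ {t : ℝ} (ht : t < 0) (k : ℕ) :
    (-t) ^ (-((k : ℝ) + 1) / 2) = (Real.sqrt (-t))⁻¹ ^ (k + 1) := by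
  rw [show -((k : ℝ) + 1) / 2 = (1 / 2 : ℝ) * (-(((k + 1 : ℕ) : ℝ))) by push_cast; ring,
    Real.rpow_mul (neg_pos.2 ht).le, ← Real.sqrt_eq_rpow, Real.rpow_neg (Real.sqrt_nonneg _),
    Real.rpow_natCast, inv_pow]

/-- **Stub `stub_scaleInvariantBounds_of_unitTime` (rescaling bookkeeping).** If unit-viscosity
classical Navier–Stokes flows on `ℝ³ × (−∞, 0)` with the global time-Type-I bound of constant `C`
have `‖Dᵏu(−1, ·)‖ ≤ C'_k` (`k ≥ 1`, constants depending on `C` only), then classical flows with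
any viscosity `ν > 0` and the Type-I bound of constant `C` obey the scale-invariant bounds
`‖Dᵏv(t, x)‖ ≤ C''_k (−t)^{−(k+1)/2}` for all `k ≥ 1`, `t < 0`, `x`, with `C''_k` depending on
`(ν, C, k)` only: rescale `w(s, y) = (L/m) v(−t s, L m y)`, `L = √(−t)`, `m = √ν`, which has
viscosity `1`, the Type-I bound with constant `C/√ν` and `w(−1, y) = (L/m) v(t, L m y)`, and undo
the homothety in the `k`-th derivative.
[cite: KochNadirashviliSereginSverak2009, §1 (1.3) and §4] -/
theorem stub_scaleInvariantBounds_of_unitTime :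
    (∀ C : ℝ, ∃ C' : ℕ → ℝ,
      ∀ (u : ℝ → EuclideanSpace ℝ (Fin 3) → EuclideanSpace ℝ (Fin 3))
        (p : ℝ → EuclideanSpace ℝ (Fin 3) → ℝ),
        Literature.Analysis.FluidPDE.IsClassicalNSSolutionOn (Set.Iio 0) 1 0 u p →
        Literature.Analysis.FluidPDE.HasTypeITimeDecay C u →
        ∀ k : ℕ, 1 ≤ k → ∀ x : EuclideanSpace ℝ (Fin 3), ‖iteratedFDeriv ℝ k (u (-1)) x‖ ≤ C' k) →
    ∀ ν C : ℝ, 0 < ν → ∃ C' : ℕ → ℝ,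
      ∀ (v : ℝ → EuclideanSpace ℝ (Fin 3) → EuclideanSpace ℝ (Fin 3))
        (q : ℝ → EuclideanSpace ℝ (Fin 3) → ℝ),
        Literature.Analysis.FluidPDE.IsClassicalNSSolutionOn (Set.Iio 0) ν 0 v q →
        Literature.Analysis.FluidPDE.HasTypeITimeDecay C v →
        ∀ k : ℕ, 1 ≤ k → ∀ t : ℝ, t < 0 → ∀ x : EuclideanSpace ℝ (Fin 3),
          ‖iteratedFDeriv ℝ k (v t) x‖ ≤ C' k * (-t) ^ (-((k : ℝ) + 1) / 2) := by
  intro H ν C hν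
  -- the Type-I constant after the rescaling is `C / √ν`
  set m : ℝ := Real.sqrt ν
  have hm0 : 0 < m := Real.sqrt_pos.2 hν
  have hmm : m * m = ν := Real.mul_self_sqrt hν.le
  obtain ⟨C', hC'⟩ := H (C / m)
  refine ⟨fun k => m * m⁻¹ ^ k * C' k, ?_⟩
  intro v q hv hC k hk t ht x
  -- the parabolic scale `L = √(−t)`
  set L : ℝ := Real.sqrt (-t) with hL
  have ht' : 0 < -t := neg_pos.2 ht
  have hL0 : 0 < L := Real.sqrt_pos.2 ht'
  have hLL : L * L = -t := Real.mul_self_sqrt ht'.le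
  have hα : 0 < L / m := div_pos hL0 hm0
  have hγ : 0 < L * m := mul_pos hL0 hm0
  -- the rescaled flow `w(s, y) = (L/m) v(−t s, L m y)` has viscosity `1` and zero force on `(−∞, 0)`
  have key := hv.stRescale (α := L / m) (β := -t) (γ := L * m) hα hγ
    (by rw [← hLL]; field_simp) 0 0
  have hvisc : L / m * ν / (L * m) = 1 := by
    rw [← hmm]
    field_simp
  rw [preimage_zero_add_mul_Iio ht', hvisc, smul_stPull_zero] at key
  -- ... and the Type-I bound with constant `C / √ν`
  have hTI : HasTypeITimeDecay (C / m) ((L / m) • stPull (-t) (L * m) 0 0 v) := by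
    intro s hs y
    have hts : -t * s < 0 := mul_neg_of_pos_of_neg ht' hs
    have h1 := hC (-t * s) hts ((L * m) • y)
    have hsq : Real.sqrt (-(-t * s)) = L * Real.sqrt (-s) := by
      rw [show -(-t * s) = -t * -s by ring, Real.sqrt_mul ht'.le]
    have hs0 : 0 < Real.sqrt (-s) := Real.sqrt_pos.2 (neg_pos.2 hs)
    have hwsy : ((L / m) • stPull (-t) (L * m) 0 0 v) s y = (L / m) • v (-t * s) ((L * m) • y) := by
      simp only [Pi.smul_apply, stPull_apply, zero_add]
    calc ‖((L / m) • stPull (-t) (L * m) 0 0 v) s y‖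
        = L / m * ‖v (-t * s) ((L * m) • y)‖ := by
          rw [hwsy, norm_smul, Real.norm_of_nonneg hα.le]
      _ ≤ L / m * (C / Real.sqrt (-(-t * s))) := mul_le_mul_of_nonneg_left h1 hα.le
      _ = C / m / Real.sqrt (-s) := by
          rw [hsq]
          field_simp
  -- the unit-time bound for `w`, at the point `(L m)⁻¹ x`
  have hD := hC' _ _ key hTI k hk ((L * m)⁻¹ • x)
  -- undo the rescaling: `v t = (L/m)⁻¹ w(−1, (L m)⁻¹ ·)`
  have hvt : v t = fun z => (L / m)⁻¹ •
      ((L / m) • stPull (-t) (L * m) 0 0 v) (-1) ((L * m)⁻¹ • z) := by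
    funext z
    simp only [Pi.smul_apply, stPull_apply, zero_add, smul_smul, inv_mul_cancel₀ hα.ne',
      mul_inv_cancel₀ hγ.ne', one_smul, mul_neg_one, neg_neg]
  have hcomp := norm_iteratedFDeriv_comp_smul_le (((L / m) • stPull (-t) (L * m) 0 0 v) (-1))
    (inv_ne_zero hγ.ne') k x
  rw [hvt, iteratedFDeriv_const_smul_real, norm_smul, norm_inv, Real.norm_of_nonneg hα.le]
  calc (L / m)⁻¹ * ‖iteratedFDeriv ℝ k
          (fun z => ((L / m) • stPull (-t) (L * m) 0 0 v) (-1) ((L * m)⁻¹ • z)) x‖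
      ≤ (L / m)⁻¹ * (|(L * m)⁻¹| ^ k * C' k) :=
        mul_le_mul_of_nonneg_left
          (hcomp.trans (mul_le_mul_of_nonneg_left hD (pow_nonneg (abs_nonneg _) k)))
          (inv_pos.2 hα).le
    _ = m * m⁻¹ ^ k * C' k * (-t) ^ (-((k : ℝ) + 1) / 2) := by
        rw [rpow_neg_half_succ ht, ← hL, abs_of_pos (inv_pos.2 hγ), inv_div, mul_inv, mul_pow,
          div_eq_mul_inv]
        ring

end Summit.NavierStokesRegularity.NavierStokesRegularity.Theorems.FrequencyRigidity.TwoEndedPinning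

end
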